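import Literature.Algebra.Homology.GroupCohomologyResolutionComparison
import Mathlib.RepresentationTheory.Homological.GroupCohomology.Shapiro
import HarnessLib

/-!
# A Shapiro isomorphism `Hⁿ(G, Coind_S^G A) ≅ Hⁿ(S, A)` natural in the coefficients

Topic `Algebra/Homology`; namespace `Literature.Algebra.Homology.ResolutionComparison`.
Definitions with bodies and theorems; no named fact, no `sorry`.

Mathlib's `groupCohomology.coindIso A n : Hⁿ(G, Coind_S^G A) ≅ Hⁿ(S, A)` (Shapiro's lemma) is built
from `groupCohomologyIso`, for which Mathlib records no naturality in `A`. Here the same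
isomorphism is rebuilt from the NATURAL comparison `resolutionIso`
(`GroupCohomologyResolutionComparison`) and the `res ⊣ coind` hom-equivalence, and its naturality
in `A` is proved:

* `resResolution S P` — the restriction to `S` of a projective resolution `P` of `k` over `G`;
* `shapiroIso S P A n : Hⁿ(G, Coind_S^G A) ≅ Hⁿ(S, A)`;
* `shapiroIso_hom_naturality` — for `f : A ⟶ B` in `Rep k S`,
  `shapiroIso ≫ Hⁿ(S, f) = Hⁿ(G, coindMap f) ≫ shapiroIso`, and the element form
  `shapiroIso_hom_apply_map`.

Used to make the orbit decomposition `H^q(Γ, indFun σ) ≅ ⊕_x H^q(Γ_x, N_x)` of the integral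
structures of [Scholze2015, §V.4] compatible with a change of lattice `M ⊂ M'`.

## References

* K. S. Brown, *Cohomology of Groups*, GTM 87 (1982), III (6.2) (Shapiro's lemma), III.1.
  [Brown1982CohomologyGroups]
-/

noncomputable section

open CategoryTheory

universe u

namespace Literature.Algebra.Homology

namespace ResolutionComparison

variable {k G : Type u} [CommRing k] [Group G] (S : Subgroup G)
  (P : ProjectiveResolution (Rep.trivial k G k))

/-- The restriction to `S` of a projective resolution of `k` over `G` (restriction preserves
projectives and exactness). [cite: Brown1982CohomologyGroups, III (6.2), proof] -/
abbrev resResolution : ProjectiveResolution (Rep.trivial k S k) :=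
  (Rep.resFunctor S.subtype).mapProjectiveResolution P

/-- **Shapiro's isomorphism `Hⁿ(G, Coind_S^G A) ≅ Hⁿ(S, A)`**, assembled from the natural
comparison isomorphisms `resolutionIso` for `P` (over `G`) and `res P` (over `S`) and the
hom-equivalence `Hom_S(res P_•, A) ≅ Hom_G(P_•, Coind A)` (Mathlib
`groupCohomology.linearYonedaObjResProjectiveResolutionIso`). [cite: Brown1982CohomologyGroups, III (6.2)] -/
def shapiroIso (A : Rep.{u} k S) (n : ℕ) :
    groupCohomology (Rep.coind S.subtype A) n ≅ groupCohomology A n :=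
  resolutionIso P (Rep.coind S.subtype A) n ≪≫
    homologyIsoOfIso (groupCohomology.linearYonedaObjResProjectiveResolutionIso P A).symm n ≪≫
      (resolutionIso (resResolution S P) A n).symm

/-- **Naturality of the hom-equivalence of complexes** `Hom_S(res P_•, A) ≅ Hom_G(P_•, Coind A)` in
`A` (the `res ⊣ coind` adjunction is natural in the right variable). [folklore] -/
theorem linearYonedaObjResProjectiveResolutionIso_hom_naturality {A B : Rep.{u} k S} (f : A ⟶ B) :
    (groupCohomology.linearYonedaObjResProjectiveResolutionIso P A).hom ≫
        postcomp P.complex (Rep.coindMap S.subtype f) =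
      postcomp (resResolution S P).complex f ≫
        (groupCohomology.linearYonedaObjResProjectiveResolutionIso P B).hom := by
  ext n : 1
  rw [HomologicalComplex.comp_f, HomologicalComplex.comp_f, postcomp_f, postcomp_f]
  refine ModuleCat.hom_ext (LinearMap.ext fun g => ?_)
  refine Rep.hom_ext (Representation.IntertwiningMap.ext (LinearMap.ext fun x => ?_))
  refine Subtype.ext (funext fun h => ?_)
  rfl

/-- Inverse form of the naturality of the hom-equivalence of complexes. [folklore] -/
theorem postcomp_comp_linearYonedaObjResProjectiveResolutionIso_inv {A B : Rep.{u} k S}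
    (f : A ⟶ B) :
    postcomp P.complex (Rep.coindMap S.subtype f) ≫
        (groupCohomology.linearYonedaObjResProjectiveResolutionIso P B).inv =
      (groupCohomology.linearYonedaObjResProjectiveResolutionIso P A).inv ≫
        postcomp (resResolution S P).complex f := by
  rw [Iso.comp_inv_eq, Category.assoc, Iso.eq_inv_comp,
    linearYonedaObjResProjectiveResolutionIso_hom_naturality]

/-- **Naturality of the Shapiro isomorphism in the coefficients**: for `f : A ⟶ B` in `Rep k S`,
`shapiroIso ≫ Hⁿ(S, f) = Hⁿ(G, coind f) ≫ shapiroIso`. [cite: Brown1982CohomologyGroups, III (6.2)] -/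
theorem shapiroIso_hom_naturality {A B : Rep.{u} k S} (f : A ⟶ B) (n : ℕ) :
    (shapiroIso S P A n).hom ≫ groupCohomology.map (MonoidHom.id S) f n =
      groupCohomology.map (MonoidHom.id G) (Rep.coindMap S.subtype f) n ≫
        (shapiroIso S P B n).hom := by
  have hS := resolutionIso_hom_naturality (resResolution S P) f n
  have hG := resolutionIso_hom_naturality P (Rep.coindMap S.subtype f) n
  -- inverse form of `hS`
  have hS' : HomologicalComplex.homologyMap (postcomp (resResolution S P).complex f) n ≫
      (resolutionIso (resResolution S P) B n).inv =
        (resolutionIso (resResolution S P) A n).inv ≫ groupCohomology.map (MonoidHom.id S) f n := by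
    rw [Iso.comp_inv_eq, Category.assoc, Iso.eq_inv_comp, hS]
  simp only [shapiroIso, Iso.trans_hom, Iso.symm_hom, homologyIsoOfIso, Iso.symm_inv, Category.assoc]
  rw [← hS', ← Category.assoc (HomologicalComplex.homologyMap _ n),
    ← HomologicalComplex.homologyMap_comp,
    ← postcomp_comp_linearYonedaObjResProjectiveResolutionIso_inv S P f,
    HomologicalComplex.homologyMap_comp, Category.assoc, ← Category.assoc _ _ (_ ≫ _),  hG,
    Category.assoc]

/-- Element form of the naturality of `shapiroIso`. [folklore] -/
theorem shapiroIso_hom_apply_map {A B : Rep.{u} k S} (f : A ⟶ B) (n : ℕ)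
    (x : groupCohomology (Rep.coind S.subtype A) n) :
    (shapiroIso S P B n).hom
        (groupCohomology.map (MonoidHom.id G) (Rep.coindMap S.subtype f) n x) =
      groupCohomology.map (MonoidHom.id S) f n ((shapiroIso S P A n).hom x) := by
  have h := LinearMap.congr_fun (congrArg ModuleCat.Hom.hom (shapiroIso_hom_naturality S P f n)) x
  simp only [ModuleCat.hom_comp, LinearMap.comp_apply] at h
  exact h.symm

/-- Element form, inverse direction. [folklore] -/
theorem shapiroIso_inv_apply_map {A B : Rep.{u} k S} (f : A ⟶ B) (n : ℕ)
    (y : groupCohomology A n) :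
    (shapiroIso S P B n).inv (groupCohomology.map (MonoidHom.id S) f n y) =
      groupCohomology.map (MonoidHom.id G) (Rep.coindMap S.subtype f) n
        ((shapiroIso S P A n).inv y) := by
  apply (shapiroIso S P B n).toLinearEquiv.injective
  change (shapiroIso S P B n).hom ((shapiroIso S P B n).inv _) =
    (shapiroIso S P B n).hom (groupCohomology.map (MonoidHom.id G) _ n ((shapiroIso S P A n).inv y))
  rw [shapiroIso_hom_apply_map]
  have h1 := LinearMap.congr_fun (congrArg ModuleCat.Hom.hom (shapiroIso S P B n).inv_hom_id)
    (groupCohomology.map (MonoidHom.id S) f n y)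
  have h2 := LinearMap.congr_fun (congrArg ModuleCat.Hom.hom (shapiroIso S P A n).inv_hom_id) y
  simp only [ModuleCat.hom_comp, LinearMap.comp_apply, ModuleCat.hom_id, LinearMap.id_apply] at h1 h2
  rw [h1, h2]

end ResolutionComparison

end Literature.Algebra.Homology
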